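import Mathlib
import HarnessLib
import HarnessLib.Audit
import Summits.ResolutionOfSingularities.Statement
import HarnessLib.Audit.Status.Attr

/-!
Route: InertialGeneration

# Route InertialGeneration — inertial generation of every place isolates the rational function
fields; resolve those, patch, descend

BARRIER-INVERSION route (operator C, fifth reading of the catalogue: the PROJECTION reading). It
suffices to show X = HG ∧ RatLU ∧ Split
together with the perfect-field frame shared verbatim with ShadowGame / WildCones / FrobeniusClosing
/ FoliationDescent (PatchingRelPerfect
stmt-16161, DescentPerfectToAll stmt-0549). HG = InertiallyGenerated (crux 2, the NEW LEVER): every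
finitely generated field K over a PERFECT
field k of characteristic p is, at EVERY valuation ring O ⊇ k, inertially generated in Kuhlmann's
sense — there are algebraically independent
x ∈ K and u ∈ O with K = k(x, u), where u solves a square polynomial system with coefficients in O ∩
k(x) whose Jacobian at u is a unit of O
(multidimensional Hensel witness; by Knaf–Kuhlmann 2009 Lemma 3.7 this says O is local-étale over O
∩ k(x), i.e. K lies in the absolute
inertia field of (k(x), O ∩ k(x))). RatLU = RationalFieldUniformization (crux 3, the ISOLATED
GEOMETRIC CORE): relative Zariski local
uniformization for the RATIONAL FUNCTION FIELDS k(x₁,…,xₙ) over perfect k — the body of Valuative's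
LUrel for K purely transcendental
(equivalently: resolution of every variety birational to Pⁿ, i.e. weak principalization of ideal
sheaves on Pⁿ; not to be confused with
residue-rational valuations of route AbhyankarShadows). Split (crux 4, the consumed reduction,
provable): HG → RatLU → relative LU over
perfect fields, verbatim the antecedent of PatchingRelPerfect. Kuhlmann 2000 Thm 6.2 gives the
converse LU ⇒ HG (support
InertiallyGeneratedOfUniformization), so the split LUrel ⟺ HG ∧ RatLU is LOSSLESS and every crux is
a consequence of the summit. No card
is realised (barrier-derived route); supports: InertiallyGeneratedAbhyankar (Knaf–Kuhlmann 2005,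
provable from tree facts),
RationalResolutionSuffices (scheme form of RatLU).
Lean: `InertiallyGenerated ∧ RationalFieldUniformization ∧ Split ∧ PatchingRelPerfect ∧
DescentPerfectToAll`

## Assembly
Pure logic, certified sorry-free (Sketch.lean = glue.lean: lean check rc 0, 0 sorries): Split
applied to InertiallyGenerated and
RationalFieldUniformization is relative LU over perfect fields, verbatim the antecedent of
PatchingRelPerfect at p; PatchingRelPerfect p hp
turns it into resolution of every reduced separated finite-type scheme over every perfect field of
characteristic p; DescentPerfectToAll p hp
into ResolutionInChar p; the summit is ∀ p prime, ResolutionInChar p by definition: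
`closes hI hR hS hP hD := fun p hp => hD p hp (hP p hp (hS hI hR p hp))` — every crux is a binder
and occurs in the term. The route file needs
nothing beyond Mathlib and the Statement's module (no Literature module carrying an unproved fact
enters the cone); PatchingRelPerfect and
DescentPerfectToAll are byte-identical to ShadowGame's decls, so dedup attaches this route to
stmt-16161 / stmt-0549.

Rationale: WHY THIS LINE. Assume the catalogue. ArtinSchreierPuiseux with its 2026-08-14 audit (uniformizer
reparametrisation x = a(s) succeeds where x = sⁿ fails)
says: parametrise by NEW TRANSCENDENTALS adapted to the valuation; LocalMonomializationFails with
its audit (simultaneous resolution holds where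
monomialisation of the defect-2 map fails) and DimensionFourFrontier (CutkoskyMourtada2019: defect
in finite projections is the only
obstruction, and ELU_m ⇒ LU_(m−1) loses a dimension through the primitive element) say: never
monomialise or climb a finite extension —
choose the projection so that K | k(x) is h-TRIVIAL at the valuation, for an étale map needs no
monomialisation and loses no dimension;
the five pointwise-invariant barriers say: file no blow-up invariant; InseparableBaseChange ×3 say:
a smoothness statement lives over perfect
fields. The object these constraints force is Kuhlmann's INERTIAL GENERATION (Kuhlmann2000 §6:
inertia degree ig(F,T) = 1), known to be
NECESSARY for local uniformization (Thm 6.2 — "in the context of valuation theory, at least to me, a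
quite surprising assertion"), whose
sufficiency is his Open Problem 1; the route observes that sufficiency holds EXACTLY modulo local
uniformization of the rational function
field (Split: the Hensel system over a regular algebraic local ring A₀ of k(x) is étale over A₀,
hence regular, and cofinality of such A₀ in
O ∩ k(x) absorbs any finitely generated R ⊆ O), so the summit reduces losslessly to two strictly
weaker statements: HG (pure valuation theory
of function fields: KnafKuhlmann2005 proves it for Abhyankar places via the Generalized Stability
Theorem Kuhlmann2010; the attack on the rest
is Kuhlmann's Open Problems 9/10 — lower ig(F,T) by Artin–Schreier inversion and surgery, proved
over tame bases as henselian rationality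
Kuhlmann2019) and RatLU (resolution of ONE explicit class, the varieties birational to Pⁿ, where
weak principalization, toric and
Newton-polyhedral methods apply). Imported area: the ramification/structure theory of valued
function fields (Kuhlmann school), already
vendored in Literature/AlgebraicGeometry/Resolution (GeneralizedStability*, Kuhlmann2019*,
KnafKuhlmann2005/2009*, Henselization*) as tools for
Valuative's α_p-torsor crux — here it supplies the THESIS. What no open route does: CyclicCovers
CLIMBS degree-p extensions (ascent), Valuative
reduces to α_p-torsors by Temkin's inseparable alteration, IndSmooth factors through non-injective
smooth algebras (Popescu), AbhyankarShadows
approximates by Abhyankar semivaluations (Teissier); this line DESCENDS — it chooses the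
transcendence basis so that nothing has to be climbed —
and relocates all residual geometry to rational varieties. Negatives index: empty at filing.

RANKED CRUXES. #2 InertiallyGenerated (crux) — for every prime p, every perfect field k of
characteristic p, every finitely generated field extension K/k and every valuation ring O of K
containing k, there are n, m, an algebraically independent x : Fin n → K, u : Fin m → K inside O and
a square system g : Fin m → K[U₁..U_m] with K = k(x, u), all coefficients of g in O ∩ k(x), g(u) = 0
and det(∂g_j/∂U_i (u)) a unit of O (Kuhlmann's inertial generation, Hensel-witness form).
[difficulty: open-problem] (why it might fail: non-Abhyankar places: no transcendence basis with
h-trivial extension is known when every Abhyankar subfunction field of K carries dependent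
Artin–Schreier defect (Kuhlmann OP9/10 open; Example 26/27-type fields); in rank > 1 the residue
field of the coarsening need not be finitely generated.) [Kuhlmann2000, KnafKuhlmann2005,
KnafKuhlmann2009, Kuhlmann2010, Kuhlmann2019, CutkoskyMourtada2019]
#3 RationalFieldUniformization (crux) — for every prime p, every perfect field k of characteristic p
and every purely transcendental K = k(x₁,…,xₙ): relative Zariski local uniformization — every
finitely generated k-subalgebra R of a valuation ring O ⊇ k of K is contained in a finitely
generated A ⊆ O with Frac A = K whose localisation at the centre of O is regular (Valuative's LUrel
body for the rational function field). [difficulty: open-problem] (why it might fail: equivalent to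
weak principalization of ideal sheaves on Pⁿ over perfect fields; blow-up charts w·g = f of Aⁿ carry
every isolated hypersurface singularity type times a line (finite determinacy), so for n ≥ 5 it
contains the wild hypersurface core; open for n ≥ 4.) [Kuhlmann2000, KnafKuhlmann2005,
CossartPiltant2019, Hironaka1964, arXiv:1401.5204]
#4 Split (crux) — InertiallyGenerated and RationalFieldUniformization imply relative local
uniformization over perfect fields of characteristic p (verbatim the antecedent of
PatchingRelPerfect): a regular algebraic local ring A₀ of k(x) inside O ∩ k(x) containing the
coefficients makes (A₀[U]/(g))_q étale over A₀, hence a regular algebraic local ring of K dominated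
by O, and cofinality of such A₀ absorbs any finitely generated R ⊆ O. [deps: InertiallyGenerated,
RationalFieldUniformization] [difficulty: L] (why it might fail: it should not: Knaf–Kuhlmann 2009
Lemma 3.7 / Prop. 3.2 made rank-free by the square Hensel system; delicate points are that
(A₀[U]/(g))_q injects into K (flatness + domain) and that the directed union of these local rings is
O (integral closure of O ∩ k(x) by normality, units).) [KnafKuhlmann2009, Kuhlmann2000,
KnafKuhlmann2005]
#5 PatchingRelPerfect (crux) — for every prime p: relative local uniformization for all finitely
generated K over all perfect fields k of characteristic p (all valuation rings) implies that every
reduced separated scheme of finite type over every perfect field of characteristic p has a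
resolution (Zariski–Piltant patching; shared verbatim, stmt-16161). [deps: Split] [difficulty:
open-problem] (why it might fail: patching finitely many local uniformizations into a proper regular
model is printed only up to dimension 3 (Piltant 2013; CossartPiltant2019 Prop. 4.8); no fourth step
is known (DimensionFourFrontier), though resolution itself implies it.) [CossartPiltant2019,
NovacoskiSpivakovsky2016, Kollar2007]
#6 DescentPerfectToAll (crux) — for every prime p: resolution of every reduced separated finite-type
scheme over every PERFECT field of characteristic p implies ResolutionInChar p (all fields; shared
verbatim, stmt-0549). [deps: PatchingRelPerfect] [difficulty: L] (why it might fail: regularity and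
HasResolution are not stable under inseparable ground-field extension
(InseparableBaseChangeResolution, RegularNotGeometricallyRegular); the descent needs spreading out
over a finitely generated imperfect k plus openness of Reg, possibly open as stated.)
[CossartPiltant2019, Temkin2013, Kollar2007]
#9 InertiallyGeneratedOfUniformization (support) — Kuhlmann 2000 Thm 6.2 typed: relative local
uniformization over perfect fields implies InertiallyGenerated (a regular centre over a perfect
field is smooth, hence an étale neighbourhood of affine space, hence locally standard étale: one
monic g with g'(u) a unit, m = 1) — certifies that the crux is a consequence of the summit.
[difficulty: provable-now] [Kuhlmann2000, KnafKuhlmann2009]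
#9 InertiallyGeneratedAbhyankar (support) — inertial generation of ABHYANKAR places: an Abhyankar
datum (x in O with rationally independent values, units y with algebraically independent residues, K
algebraic over k(x, y)) yields the Hensel witness (Knaf–Kuhlmann 2005 Thm 1.1/§5 via Generalized
Stability; tree: KnafKuhlmann2005_Thm34_etale, GeneralizedStabilityHolds) — the known first rung of
crux 2. [difficulty: L] [KnafKuhlmann2005, Kuhlmann2010]
#9 RationalResolutionSuffices (support) — resolution of every affine model Spec B of a rational
function field over a perfect field (B finitely generated with Frac B = k(x)) implies
RationalFieldUniformization (valuative criterion of properness; cofinality by adjoining generators)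
— the scheme form provers of crux 3 may prefer. [difficulty: M] [Kollar2007, CossartPiltant2019]

TWO-LAYER PLAN. Foreseen glued splits (the BC3 birth skeletons, bc/*_birth.lean, rc 0, sorries =
stubs): InertiallyGenerated ⇐ DenseBasis (rank-one density
form: some separating transcendence basis z ⊆ O with k(z) O-dense in K — the open core) →
DenseToWitness (Kuhlmann 2000 Prop 15.7 / Cor 8 +
KK09 Lemma 3.7) → RankReduction (composition of places); RationalFieldUniformization ⇐
RationalResolution (resolve affine models of k(x) =
weak principalization on Pⁿ) → ResolutionToUniformization (valuative criterion); Split ⇐ Exhaust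
(coefficient model, cofinality) →
EtaleRegular (étale over regular is regular, absorb R). k ≤ 3 each, depth 1.

KILL CRITERIA. A finitely generated field over F̄_p (transcendence degree ≥ 4) with a valuation ring
that is NOT inertially generated refutes InertiallyGenerated —
and, by Kuhlmann's Thm 6.2 (support InertiallyGeneratedOfUniformization), local uniformization and
hence THE SUMMIT in that dimension: close
`refuted:InertiallyGenerated` and hand the witness to WildPurity / the negatives index as a
summit-level counterexample candidate. A refutation
of RationalFieldUniformization is likewise a counterexample to the summit (rational varieties are
varieties). A refutation of Split means the
planner's algebra is wrong: pivot to the rank-one henselization form (Kuhlmann Cor. 8) with an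
explicit rank-reduction crux. PatchingRelPerfect /
DescentPerfectToAll share their fate with five routes. Valuative's LUrel proved elsewhere moots
cruxes 2–4 (they follow), not the route.

NOT DECOMPOSED YET. The rank-one density form, the transcendence-defect induction (Temkin's
architecture, tree InseparableLocalUniformizationDefect) and the
Artin–Schreier-inversion step of crux 2; the scheme form / weak principalization of crux 3 beyond
the support; the reduction of patching to two
models (Piltant) — all layer-2 children after a first closure. The Abhyankar case of crux 2 is filed
as a support, not a child.

CHEAPEST FALSIFIER. (i) Literature: is "every place of a function field over a perfect field is
inertially generated" already REFUTED in print? Searched: Kuhlmann2000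
§19 — Example 26 (F_p(x₁,x₂,y,z), zᵖ − z = x₁ − x₂yᵖ) is non-henselian-generated only relative to
the FIXED subfield F_p(x₁,x₂) and F is rational,
and Open Problem 8 records that no method to prove non-inertial-generation of a function field is
known — not refuted. (ii) Computation a
refuter can run this week: for the explicit rank-one valuations of the catalogue (Cutkosky's ν* —
rational field, trivial; Hauser–Perlega's
kangaroo valuations on k(x₁..x₄)(z), z^8 + F = 0; Kuhlmann's Example 27 field K(t, z, ϑ_f)) exhibit
or fail to exhibit a separating
transcendence basis T with k(T) dense (density form of crux 2 in rank one). (iii) Lean: prove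
InertiallyGeneratedOfUniformization — if the
typed crux does not follow from LUrel the typing is wrong.

NUMBERS. Known: resolution / LU in dimension ≤ 3, all characteristics (CossartPiltant2019) ⇒ cruxes
2–3 are theorems for transcendence degree ≤ 3;
inertial generation of all Abhyankar places (KnafKuhlmann2005, residue extension separable —
automatic over perfect k); LU after a finite
extension of the function field for every place (KnafKuhlmann2009); henselian rationality over tame
/ separably tame bases (Kuhlmann2019
Thm 1.3). Open: cruxes 2–3 for transcendence degree ≥ 4. Kuhlmann's measure: inertia degree ig(F,T)
= [F·K(T)^i : K(T)^i] (crux 2 ⟺ ∃ T,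
ig = 1). Items at open: 9 (5 cruxes, 3 supports, 1 assembly).

DEFINITION REQUESTS. None: every statement is over Mathlib (ValuationSubring,
IntermediateField.adjoin, AlgebraicIndependent, MvPolynomial.pderiv, Matrix.det,
Localization.AtPrime, IsRegularLocalRing, Scheme.HasResolution from the Statement's module).
Henselization / absolute inertia field exist in
Literature (ambient rendering, Henselization*.lean) and are deliberately avoided in the items (the
Hensel-witness form is rank-free, KK09 Lemma 3.7).

Novelty: Searches (2026-08-17): `lit search --hybrid "inertially generated function field local
uniformization Kuhlmann henselization rational function field"`
(20 docs; Kuhlmann2000 survey = arXiv:1003.5689 found and READ §§6,7,15,16,19: Thm 6.2, OP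
1,3,5,6,8,9,10,11, Examples 26–27); `lit search --source
zbmath/crossref "Kuhlmann elimination of ramification henselian rationality"` (12 rows:
Kuhlmann2010, Kuhlmann2019, Kuhlmann–Novacoski "Henselian
elements" 2014, Ershov 2008); arXiv/OpenAlex/S2 rate-limited this session (logged); `lean search
'InertiallyGenerated|henselian generated'` (tree:
Literature HenselizedFunctionFields*, InertiallyGeneratedValuationRings,
KnafKuhlmann2009HenselianRationalityEtale, ImmediateRationalUniformization —
tools for Theorems/ValuativeLuAlphaPTorsorAbhyankarDefectless, no route thesis); grep of 187 idea
cards for Kuhlmann / henselian rationality /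
defectless (33 / 3 / 9 hits, all as tools inside valuation cards: kahler-cuts, type-cocycle,
follow-valuation-break, kangaroo-valuations — none
asserts inertial generation of all places or the rational-field split); the 26+1 open routes read
(open_routes.json + AbhyankarShadows).
Nearest prior art found: Kuhlmann2000 (arXiv:1003.5689) Thm 6.2 / Open Problems 1 and 9 (the notion,
its necessity, the open converse, the
measure ig(F,T)); KnafKuhlmann2009 (LU in a finite extension of F — the price of not having inertial
generation); routes IndSmooth, CyclicCovers,
Valuative, AbhyankarShadows (other LU engines ins  [refs: 1003.5689, Kuhlmann2000, Kuhlmann2010, Kuhlmann2019, KnafKuhlmann2009]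

Barriers (technique_class: inertial-generation henselian-rationality etale-descent): - technique_class: inertial-generation henselian-rationality etale-descent
- Literature.Barriers.ResolutionOfSingularities.chevalley_barrier: evaded and inverted — no
Puiseux/monomial reparametrisation is used; the route's object is exactly the audit's escape (new
transcendentals x = a(s), ArtinSchreierPuiseuxNarrow): a valuation-adapted transcendence basis.
- Literature.Barriers.ResolutionOfSingularities.Cutkosky2014: evaded — no finite map is
monomialised; K | k(x) is made étale at O (nothing to monomialise); Cutkosky's K* = k(x,y) is
rational, where HG holds with T = (x,y) and RatLU is the whole content.
- Literature.Barriers.ResolutionOfSingularities.DimensionFourFrontier: respected — LU_n is proved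
for every n (necessary by LocalUniformizationUpToDim.of_resolutionInChar) as Split(HG, RatLU), and
patching is the explicit shared crux PatchingRelPerfect; the bet is that the frontier's missing
ELU_4 is needed only for the RATIONAL function field (crux 3).
- Literature.Barriers.ResolutionOfSingularities.Hauser2003_kangarooShadeIncrease: not engaged — no
residual order, no hypersurface of contact, no blow-up sequence is filed (RatLU is weak-form
existence).
- Literature.Barriers.ResolutionOfSingularities.hauserPerlega_mohProofBoundFails: not engaged — no
invariant along blow-ups; HP's valuations are test instances for the density form of crux 2.
- Literature.Barriers.ResolutionOfSingularities.Narasimhan1983_noSmoothHypersurfaceThroughTopLocus: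
not engaged — no maximal contact.

History (route lifecycle, newest last):
- 2026-08-25T06:26:09Z · DORMANT — reconciler: no traction for 7.5 d (last activity item-evidence-added at 2026-08-17T19:03:53Z); parked, not closed — `ledger route dormant route-ResolutionOfSing (operator:999:1398231)
- 2026-08-26T17:01:52Z · REACTIVATED — reconciler: reactivated — activity statement-claimed at 2026-08-26T16:25:04Z after parking at 2026-08-25T06:26:09Z (operator:999:3590970)

sub-problem: ResolutionOfSingularities · status: open · opened planner-plan-novel-ResolutionOfSingularities-Re-dc19aa3a-c-v2-g12-0 2026-08-17T01:01:45Z · rev 2 · ledger route-ResolutionOfSingularities-InertialGeneration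
GENERATED by the gate from the ledger (D-0016/17). Provers cite these decls: `theorem foo : Summit.ResolutionOfSingularities.ResolutionOfSingularities.Theses.InertialGeneration.<Decl> := …` in Summits/ResolutionOfSingularities/ResolutionOfSingularities/Theorems/<Name>.lean.
-/

namespace Summit.ResolutionOfSingularities.ResolutionOfSingularities.Theses.InertialGeneration

open scoped BigOperators Topology Manifold Classical MeasureTheory ProbabilityTheory Matrix InnerProductSpace ComplexConjugate ContinuousMap
open Filter Set Function TopologicalSpace MeasureTheory

attribute [summit_statement] _root_.ResolutionOfSingularities

/-- item stmt-ResolutionOfSingularities-17003 · crux · rank 2 · open · by planner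
why it might fail: non-Abhyankar places: no transcendence basis with h-trivial extension is known when every Abhyankar subfunction field of K carries dependent Artin–Schreier defect (Kuhlmann OP9/10 open; Example 26/27-type fields); in rank > 1 the residue field of the coarsening need not be finitely generated.
sources: Kuhlmann2000, KnafKuhlmann2005, KnafKuhlmann2009, Kuhlmann2010, Kuhlmann2019, CutkoskyMourtada2019
[crux] for every prime p, every perfect field k of characteristic p, every finitely generated field
extension K/k and every valuation ring O of K containing k, there are n, m, an algebraically
independent x : Fin n → K, u : Fin m → K inside O and a square system g : Fin m → K[U₁..U_m] with K
= k(x, u), all coefficients of g in O ∩ k(x), g(u) = 0 and det(∂g_j/∂U_i (u)) a unit of O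
(Kuhlmann's inertial generation, Hensel-witness form). [difficulty: open-problem] -/
@[route_item "route-ResolutionOfSingularities-InertialGeneration", crux]
def InertiallyGenerated : Prop :=
  ∀ p : ℕ, p.Prime → ∀ (k K : Type) [Field k] [CharP k p] [PerfectField k] [Field K] [Algebra k K], (⊤ : IntermediateField k K).FG → ∀ O : ValuationSubring K, (∀ c : k, algebraMap k K c ∈ O) → ∃ (n m : ℕ) (x : Fin n → K) (u : Fin m → K) (g : Fin m → MvPolynomial (Fin m) K), AlgebraicIndependent k x ∧ IntermediateField.adjoin k (Set.range x ∪ Set.range u) = ⊤ ∧ (∀ j, u j ∈ O) ∧ (∀ j s, MvPolynomial.coeff s (g j) ∈ O ∧ MvPolynomial.coeff s (g j) ∈ IntermediateField.adjoin k (Set.range x)) ∧ (∀ j, MvPolynomial.eval u (g j) = 0) ∧ ((Matrix.of fun j i => MvPolynomial.eval u (MvPolynomial.pderiv i (g j))).det ≠ 0 ∧ (Matrix.of fun j i => MvPolynomial.eval u (MvPolynomial.pderiv i (g j))).det ∈ O ∧ ((Matrix.of fun j i => MvPolynomial.eval u (MvPolynomial.pderiv i (g j))).det)⁻¹ ∈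 O)

/-- item stmt-ResolutionOfSingularities-17004 · crux · rank 3 · open · by planner
why it might fail: equivalent to weak principalization of ideal sheaves on Pⁿ over perfect fields; blow-up charts w·g = f of Aⁿ carry every isolated hypersurface singularity type times a line (finite determinacy), so for n ≥ 5 it contains the wild hypersurface core; open for n ≥ 4.
sources: Kuhlmann2000, KnafKuhlmann2005, CossartPiltant2019, Hironaka1964, arXiv:1401.5204
[crux] for every prime p, every perfect field k of characteristic p and every purely transcendental
K = k(x₁,…,xₙ): relative Zariski local uniformization — every finitely generated k-subalgebra R of a
valuation ring O ⊇ k of K is contained in a finitely generated A ⊆ O with Frac A = K whose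
localisation at the centre of O is regular (Valuative's LUrel body for the rational function field).
[difficulty: open-problem] -/
@[route_item "route-ResolutionOfSingularities-InertialGeneration", crux]
def RationalFieldUniformization : Prop :=
  ∀ p : ℕ, p.Prime → ∀ (k K : Type) [Field k] [CharP k p] [PerfectField k] [Field K] [Algebra k K] (n : ℕ) (x : Fin n → K), AlgebraicIndependent k x → IntermediateField.adjoin k (Set.range x) = ⊤ → ∀ O : ValuationSubring K, (∀ c : k, algebraMap k K c ∈ O) → ∀ R : Subalgebra k K, R.FG → R.toSubring ≤ O.toSubring → ∃ (A : Subalgebra k K) (h : A.toSubring ≤ O.toSubring), R ≤ A ∧ A.FG ∧ IsFractionRing A K ∧ IsRegularLocalRing (Localization.AtPrime (Ideal.comap (Subring.inclusion h) (IsLocalRing.maximalIdeal O)))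

/-- item stmt-ResolutionOfSingularities-17005 · crux · rank 4 · open · by planner
why it might fail: it should not: Knaf–Kuhlmann 2009 Lemma 3.7 / Prop. 3.2 made rank-free by the square Hensel system; delicate points are that (A₀[U]/(g))_q injects into K (flatness + domain) and that the directed union of these local rings is O (integral closure of O ∩ k(x) by normality, units).
sources: KnafKuhlmann2009, Kuhlmann2000, KnafKuhlmann2005
[crux] InertiallyGenerated and RationalFieldUniformization imply relative local uniformization over
perfect fields of characteristic p (verbatim the antecedent of PatchingRelPerfect): a regular
algebraic local ring A₀ of k(x) inside O ∩ k(x) containing the coefficients makes (A₀[U]/(g))_q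
étale over A₀, hence a regular algebraic local ring of K dominated by O, and cofinality of such A₀
absorbs any finitely generated R ⊆ O. [deps: InertiallyGenerated, RationalFieldUniformization]
[difficulty: L] -/
@[route_item "route-ResolutionOfSingularities-InertialGeneration", crux]
def Split : Prop :=
  InertiallyGenerated → RationalFieldUniformization → ∀ p : ℕ, p.Prime → ∀ (k K : Type) [Field k] [CharP k p] [PerfectField k] [Field K] [Algebra k K], (⊤ : IntermediateField k K).FG → ∀ O : ValuationSubring K, (∀ c : k, algebraMap k K c ∈ O) → ∀ R : Subalgebra k K, R.FG → R.toSubring ≤ O.toSubring → ∃ (A : Subalgebra k K) (h : A.toSubring ≤ O.toSubring), R ≤ A ∧ A.FG ∧ IsFractionRing A K ∧ IsRegularLocalRing (Localization.AtPrime (Ideal.comap (Subring.inclusion h) (IsLocalRing.maximalIdeal O)))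

/-- item stmt-ResolutionOfSingularities-16161 · crux · rank 5 · open · by planner
why it might fail: patching finitely many local uniformizations into a proper regular model is printed only up to dimension 3 (Piltant 2013; CossartPiltant2019 Prop. 4.8); no fourth step is known (DimensionFourFrontier), though resolution itself implies it.
sources: CossartPiltant2019, NovacoskiSpivakovsky2016, Kollar2007
[crux] Zariski patching over PERFECT ground fields: for every prime p, relative local uniformization
(every f.g. R ⊆ O is dominated by a f.g. A ⊆ O with Frac A = K, regular at the centre) for all f.g.
K/k with k perfect of char p implies that every reduced separated scheme of finite type over every
perfect field of char p has a resolution. Fibrewise identical to Valuative's PatchingRel (stmt-0642)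
restricted to perfect k — one patching argument proves both. [difficulty: open-problem] -/
@[route_item "route-ResolutionOfSingularities-InertialGeneration", crux]
def PatchingRelPerfect : Prop :=
  ∀ p : ℕ, p.Prime → (∀ (k K : Type) [Field k] [CharP k p] [PerfectField k] [Field K] [Algebra k K], (⊤ : IntermediateField k K).FG → ∀ O : ValuationSubring K, (∀ c : k, algebraMap k K c ∈ O) → ∀ R : Subalgebra k K, R.FG → R.toSubring ≤ O.toSubring → ∃ (A : Subalgebra k K) (h : A.toSubring ≤ O.toSubring), R ≤ A ∧ A.FG ∧ IsFractionRing A K ∧ IsRegularLocalRing (Localization.AtPrime (Ideal.comap (Subring.inclusion h) (IsLocalRing.maximalIdeal O)))) → ∀ (k : Type) [Field k] [CharP k p] [PerfectField k] (X : AlgebraicGeometry.Scheme.{0}) (f : X ⟶ AlgebraicGeometry.Spec (.of k)), AlgebraicGeometry.IsSeparated f → AlgebraicGeometry.LocallyOfFiniteType f → AlgebraicGeometry.QuasiCompact f → AlgebraicGeometry.IsReduced X → Literature.AlgebraicGeometry.Resolution.Scheme.HasResolution X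

/-- item stmt-ResolutionOfSingularities-0549 · crux · rank 6 · open · by planner
why it might fail: regularity and HasResolution are not stable under inseparable ground-field extension (InseparableBaseChangeResolution, RegularNotGeometricallyRegular); the descent needs spreading out over a finitely generated imperfect k plus openness of Reg, possibly open as stated.
sources: CossartPiltant2019, Temkin2013, Kollar2007
PerfectToAll: for a prime p, resolution of all reduced separated finite-type schemes over all
PERFECT fields of char p implies ResolutionInChar p (all fields of char p). Expected inputs:
Neron-Popescu (Stacks 07GC), spreading out, openness of regular locus on excellent schemes;
regularity is not stable under inseparable ground field extension, which is the difficulty. -/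
@[route_item "route-ResolutionOfSingularities-InertialGeneration", crux]
def DescentPerfectToAll : Prop :=
  ∀ p : ℕ, p.Prime → (∀ (k : Type) [Field k] [CharP k p] [PerfectField k] (X : AlgebraicGeometry.Scheme.{0}) (f : X ⟶ AlgebraicGeometry.Spec (.of k)), AlgebraicGeometry.IsSeparated f → AlgebraicGeometry.LocallyOfFiniteType f → AlgebraicGeometry.QuasiCompact f → AlgebraicGeometry.IsReduced X → Literature.AlgebraicGeometry.Resolution.Scheme.HasResolution X) → Literature.AlgebraicGeometry.Resolution.ResolutionInChar.{0} p

/-- item stmt-ResolutionOfSingularities-17006 · support · rank 9 · open · by planner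
sources: Kuhlmann2000, KnafKuhlmann2009
[support] Kuhlmann 2000 Thm 6.2 typed: relative local uniformization over perfect fields implies
InertiallyGenerated (a regular centre over a perfect field is smooth, hence an étale neighbourhood
of affine space, hence locally standard étale: one monic g with g'(u) a unit, m = 1) — certifies
that the crux is a consequence of the summit. [difficulty: provable-now] -/
@[route_item "route-ResolutionOfSingularities-InertialGeneration"]
def InertiallyGeneratedOfUniformization : Prop :=
  (∀ p : ℕ, p.Prime → ∀ (k K : Type) [Field k] [CharP k p] [PerfectField k] [Field K] [Algebra k K], (⊤ : IntermediateField k K).FG → ∀ O : ValuationSubring K, (∀ c : k, algebraMap k K c ∈ O) → ∀ R : Subalgebra k K, R.FG → R.toSubring ≤ O.toSubring → ∃ (A : Subalgebra k K) (h : A.toSubring ≤ O.toSubring), R ≤ A ∧ A.FG ∧ IsFractionRing A K ∧ IsRegularLocalRing (Localization.AtPrime (Ideal.comap (Subring.inclusion h) (IsLocalRing.maximalIdeal O)))) → InertiallyGenerated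

/-- item stmt-ResolutionOfSingularities-17007 · support · rank 9 · open · by planner
sources: KnafKuhlmann2005, Kuhlmann2010
[support] inertial generation of ABHYANKAR places: an Abhyankar datum (x in O with rationally
independent values, units y with algebraically independent residues, K algebraic over k(x, y))
yields the Hensel witness (Knaf–Kuhlmann 2005 Thm 1.1/§5 via Generalized Stability; tree:
KnafKuhlmann2005_Thm34_etale, GeneralizedStabilityHolds) — the known first rung of crux 2.
[difficulty: L] -/
@[route_item "route-ResolutionOfSingularities-InertialGeneration"]
def InertiallyGeneratedAbhyankar : Prop :=
  ∀ p : ℕ, p.Prime → ∀ (k K : Type) [Field k] [CharP k p] [PerfectField k] [Field K] [Algebra k K], (⊤ : IntermediateField k K).FG → ∀ O : ValuationSubring K, (∀ c : k, algebraMap k K c ∈ O) → ∀ (r s : ℕ) (x₀ : Fin r → K) (y₀ : Fin s → K), (∀ i, x₀ i ∈ O) → (∀ a : Fin r → ℤ, a ≠ 0 → O.valuation (∏ i, x₀ i ^ a i) ≠ 1) → (∀ j, y₀ j ∈ O ∧ (y₀ j)⁻¹ ∈ O) → (∀ q : MvPolynomial (Fin s) k, q ≠ 0 → O.valuation (MvPolynomial.aeval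 y₀ q) = 1) → Algebra.IsAlgebraic (IntermediateField.adjoin k (Set.range x₀ ∪ Set.range y₀)) K → ∃ (n m : ℕ) (x : Fin n → K) (u : Fin m → K) (g : Fin m → MvPolynomial (Fin m) K), AlgebraicIndependent k x ∧ IntermediateField.adjoin k (Set.range x ∪ Set.range u) = ⊤ ∧ (∀ j, u j ∈ O) ∧ (∀ j s, MvPolynomial.coeff s (g j) ∈ O ∧ MvPolynomial.coeff s (g j) ∈ IntermediateField.adjoin k (Set.range x)) ∧ (∀ j, MvPolynomial.eval u (g j) = 0) ∧ ((Matrix.of fun j i => MvPolynomial.eval u (MvPolynomial.pderiv i (g j))).det ≠ 0 ∧ (Matrix.of fun j i => MvPolynomial.eval u (MvPolynomial.pderiv i (g j))).det ∈ O ∧ ((Matrix.of fun j i => MvPolynomial.eval u (MvPolynomial.pderiv i (g j))).det)⁻¹ ∈ O)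

/-- item stmt-ResolutionOfSingularities-17008 · support · rank 9 · open · by planner
sources: Kollar2007, CossartPiltant2019
[support] resolution of every affine model Spec B of a rational function field over a perfect field
(B finitely generated with Frac B = k(x)) implies RationalFieldUniformization (valuative criterion
of properness; cofinality by adjoining generators) — the scheme form provers of crux 3 may prefer.
[difficulty: M] -/
@[route_item "route-ResolutionOfSingularities-InertialGeneration"]
def RationalResolutionSuffices : Prop :=
  (∀ p : ℕ, p.Prime → ∀ (k K : Type) [Field k] [CharP k p] [PerfectField k] [Field K] [Algebra k K] (n : ℕ) (x : Fin n → K), AlgebraicIndependent k x → IntermediateField.adjoin k (Set.range x) = ⊤ → ∀ B : Subalgebra k K, B.FG → IsFractionRing B K → Literature.AlgebraicGeometry.Resolution.Scheme.HasResolution (AlgebraicGeometry.Spec (.of B))) → RationalFieldUniformization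

/-- item stmt-ResolutionOfSingularities-17009 · assembly · rank 1 · open · by planner
sources: Kuhlmann2000, KnafKuhlmann2009
[assembly] InertiallyGenerated → RationalFieldUniformization → Split → PatchingRelPerfect →
DescentPerfectToAll → ResolutionOfSingularities. -/
@[route_item "route-ResolutionOfSingularities-InertialGeneration"]
def Assembly : Prop :=
  InertiallyGenerated → RationalFieldUniformization → Split → PatchingRelPerfect → DescentPerfectToAll → _root_.ResolutionOfSingularities

/-! D-0027 §2.1 — DECIDING THEOREM (planner-authored via `route open/edit --closes-file`; by planner-plan-novel-ResolutionOfSingularities-Re-dc19aa3a-c-v 2026-08-17T01:01:45Z):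
its hypotheses are this route's items and its conclusion the sub-problem Statement (glue_lint), and it elaborates with this file. -/

@[closes "route-ResolutionOfSingularities-InertialGeneration"] theorem closes (hI : InertiallyGenerated) (hR : RationalFieldUniformization) (hS : Split)
    (hP : PatchingRelPerfect) (hD : DescentPerfectToAll) : _root_.ResolutionOfSingularities :=
  fun p hp => hD p hp (hP p hp (hS hI hR p hp))

end Summit.ResolutionOfSingularities.ResolutionOfSingularities.Theses.InertialGeneration
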